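import Mathlib.NumberTheory.Zsqrtd.Basic
import Mathlib.Data.ZMod.Basic
import Mathlib.RingTheory.Coprime.Basic
import Mathlib.Tactic.Ring
import Mathlib.Tactic.Linarith
import Mathlib.Tactic.LinearCombination
import Mathlib.Tactic.NormNum
import HarnessLib

/-!
# Venture HSemireg — `ℚ(√−7)` does not reach R1 PROPER factorwise: a parity proof (ENGINE-W code B, ONE-FOURIER-FORMULA-B.md §8,
# THEOREM CF⁶ «R1 PROPER · ℚ(√−7): NOT reachable by any factorwise word») — kernel number theory in `ℤ√−7`

HONEST FRAMING. Lean index of the computation cell `pub-hsemireg`, widening group ENGINE-W (code B = the independent second code, seat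
`engine-w-2`, gen 10). ELEMENTARY NUMBER THEORY in Mathlib's `ℤ√(−7)` (norm multiplicativity and parities in `ℤ∕2`); the secant engine,
factorwise words and the R1 line enter BY VALUE (docstrings). No abelian variety, sheaf, `Ext` group or semiregularity map is constructed;
nothing here says that HC, HC_CM or HC_AV holds. Theorems only (0 `def`, 0 named fact, 0 `sorry`). Companion of code B's
`FactorwiseTransportFormula.lean` (THEOREM CF⁶'s algebra and the divisibility clause `z ∣ (A − l)`).

SOURCE (the cell's own result, code B): `widen/ENGINE-W/out/probe4/ONE-FOURIER-FORMULA-B.md` §8 (v1.4, engine-w-2 g4). By THEOREM CF⁶ ∕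
COROLLARY «reachable LINES» (by value), the R1 PROPER line `(1⁵, 2) ∝ (1∕2,…,1∕2, 1)` is reached factorwise from split with node field
`k′ = ℚ(l)`, `l² = m`, iff there are PRIMITIVE `z_j ∈ ℤ[l]` with `N(z_j) = 2t` (`j ≤ 5`), `N(z₆) = t` and a COMMON `A ∈ ℤ` with
`z_j ∣ (A − l)` in the order `ℤ[l]` for all `j`. §8 as printed: «`ℚ(i)`, `ℚ(√−2)`, silver `ℚ(√2)`: explicit words … **`ℚ(√−7)`: NOT reachable
by any factorwise word, although the CLASS `{2}` is** (atlas `(7,1,1) → (8⁵,1)`)», proved there 2-adically (conductor of `ℤ[√−7]`; machine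
leg: no pair `(z, z₆)` with `|x|, |y| ≤ 400` among 9 281 candidate `t`). PRIOR STATEMENT OF RECORD (stronger, code A): THEOREM R1-ℤ ∕
R1-DIOPHANTINE (`widen/ENGINE-W/out/probe5/PROBE5-STIZ-A.md` §3, §13, engine-w-1 g5–g6, 2026-08-23): for `m ≡ 1 (mod 4)` the `ℤ[√m]`-type
node-pair seed never reaches R1 PROPER under the FULL integral group (r-shadow of the module invariant `(Λ, 𝒥)`); the present file re-derives
the factorwise half for `m = −7` by an independent method. THIS FILE gives a VALUATION-FREE proof using only ONE of the five `z_j`: if `z = x + yl` is primitive of even norm then `x, y` are odd, and then any cofactor `w` with `z·w = A − l` has ODD norm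
(`im`-component: `xq + yp = −1` forces exactly one of `p, q` odd); so `A² + 7 = N(A − l) = 2t·odd`; in particular `A` is odd and
`4 ∣ t`, so `z₆` (primitive, norm `t` even) also has odd coordinates and `A² + 7 = t·odd`; hence `2t·odd = t·odd` with `t ≠ 0` —
impossible. What the kernel holds:

* §1 parity transfer `ℤ ↔ ℤ∕2` and two `decide` facts in `ℤ∕2`: `coprime_even_norm_forces_odd` (`aX + bY = 1`, `X² + 7Y² = 0` ⇒
  `X = Y = 1`) and `cofactor_norm_is_odd` (`Q + P = −1` ⇒ `P² + 7Q² = 1`).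
* §2 in `ℤ√(−7)`: `norm_A_sub_l` (`N⟨A, −1⟩ = A² + 7`); `odd_coords` (primitive + even norm ⇒ both coordinates odd); `odd_norm_cofactor`
  (`z` with odd coordinates, `z·w = ⟨A, −1⟩` ⇒ `N(w)` odd); `four_dvd_of_eq` (`A² + 7 = 2·t·n`, `n` odd ⇒ `A` odd and `4 ∣ t`).
* §3 **`r1proper_not_factorwise_sqrt_neg_seven`** — primitive `z, z₆ ∈ ℤ√(−7)` with `N(z) = 2t`, `N(z₆) = t` cannot both divide
  `A − l`: the §8 statement for `ℚ(√−7)`, in full (given the by-value reduction of THEOREM CF⁶).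
* §4 `positive_fields` — the contrast of record: in `ℤ√(−1)`, `ℤ√(−2)`, `ℤ√2` the §8 words DO satisfy the divisibilities
  (`(1+i) ∣ (1 − i)`… as explicit products: `1 − i = (1+i)(−i)`, `N(1+i) = 2 = 2·N(1)`; `−l = l·(−1)` for `l = √−2`, `A = 0`; silver
  `A = 0`: `−√2 = (2+√2)(1−√2)`, `N(2+√2) = 2`), by `decide`-free `ext`/`norm_num`.
WHAT IS NOT HERE: THEOREM CF⁶ itself and the reduction «R1 proper factorwise ⟺ such `(z_j, A)` exist» (engine facts, by value; the
algebraic clause is `FactorwiseTransportFormula.residue_class_iff`), factor-MIXING elements of `U(A × Â)` (§10 of the source: OPEN for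
`ℚ(√−7)`), THEOREM STI. Tier of the source: hand ×1 (B, 2-adic) + machine ×1 (B); this kernel proof is a second, independent HAND route.
-/

namespace Summit.Ventures.HSemireg.R1SqrtMinusSeven

/-! ## §1 Parities -/

/-- `Odd x ⇒ x = 1` in `ℤ∕2`. [kernel] -/
theorem cast_eq_one_of_odd (x : ℤ) (hx : Odd x) : (x : ZMod 2) = 1 := by
  obtain ⟨k, rfl⟩ := hx
  push_cast
  have : (2 : ZMod 2) = 0 := by decide
  rw [this]; ring

/-- `x = 1` in `ℤ∕2` ⇒ `Odd x`. [kernel] -/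
theorem odd_of_cast_eq_one (x : ℤ) (hx : (x : ZMod 2) = 1) : Odd x := by
  have h0 : ((x - 1 : ℤ) : ZMod 2) = 0 := by push_cast; rw [hx]; ring
  obtain ⟨k, hk⟩ := (ZMod.intCast_zmod_eq_zero_iff_dvd (x - 1) 2).1 h0
  exact ⟨k, by omega⟩

/-- In `ℤ∕2`: a primitive pair (`aX + bY = 1`) with `X² + 7Y² = 0` has `X = Y = 1`. [kernel, `decide`] -/
theorem coprime_even_norm_forces_odd : ∀ X Y a b : ZMod 2, a * X + b * Y = 1 → X ^ 2 + 7 * Y ^ 2 = 0 → X = 1 ∧ Y = 1 := by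
  decide

/-- In `ℤ∕2`: `Q + P = −1` ⇒ `P² + 7Q² = 1` (exactly one of `P, Q` is odd, so the norm `p² + 7q²` is odd). [kernel, `decide`] -/
theorem cofactor_norm_is_odd : ∀ P Q : ZMod 2, Q + P = -1 → P ^ 2 + 7 * Q ^ 2 = 1 := by
  decide

/-! ## §2 Norms and parities in `ℤ√(−7)` -/

/-- `N(A − l) = N⟨A, −1⟩ = A² + 7` in `ℤ√(−7)`. [kernel] -/
theorem norm_A_sub_l (A : ℤ) : (⟨A, -1⟩ : ℤ√(-7)).norm = A ^ 2 + 7 := by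
  rw [Zsqrtd.norm_def]; ring

/-- **Primitive of even norm ⇒ odd coordinates**: `IsCoprime x y`, `2 ∣ x² + 7y²` ⇒ `x`, `y` odd. [kernel] -/
theorem odd_coords (z : ℤ√(-7)) (hcop : IsCoprime z.re z.im) (heven : Even z.norm) : Odd z.re ∧ Odd z.im := by
  obtain ⟨a, b, hab⟩ := hcop
  have h1 : ((a * z.re + b * z.im : ℤ) : ZMod 2) = 1 := by rw [hab]; push_cast; rfl
  have hn : z.norm = z.re ^ 2 + 7 * z.im ^ 2 := by rw [Zsqrtd.norm_def]; ring
  obtain ⟨k, hk⟩ := heven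
  have h2 : ((z.re ^ 2 + 7 * z.im ^ 2 : ℤ) : ZMod 2) = 0 := by
    rw [← hn, hk]; push_cast
    have : (k : ZMod 2) + k = 2 * k := by ring
    rw [this]
    have h2z : (2 : ZMod 2) = 0 := by decide
    rw [h2z, zero_mul]
  push_cast at h1 h2
  obtain ⟨hx, hy⟩ := coprime_even_norm_forces_odd _ _ _ _ h1 h2
  exact ⟨odd_of_cast_eq_one _ hx, odd_of_cast_eq_one _ hy⟩

/-- **Cofactors have odd norm**: if `z` has odd coordinates and `z·w = A − l`, then `N(w) = p² + 7q²` is odd (the `im`-component of the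
product reads `x·q + y·p = −1`). [kernel] -/
theorem odd_norm_cofactor (A : ℤ) (z w : ℤ√(-7)) (hx : Odd z.re) (hy : Odd z.im) (h : (⟨A, -1⟩ : ℤ√(-7)) = z * w) :
    Odd w.norm := by
  have him : (-1 : ℤ) = z.re * w.im + z.im * w.re := by
    have := congrArg Zsqrtd.im h
    simpa [Zsqrtd.im_mul] using this
  have hn : w.norm = w.re ^ 2 + 7 * w.im ^ 2 := by rw [Zsqrtd.norm_def]; ring
  have h2 : ((z.re * w.im + z.im * w.re : ℤ) : ZMod 2) = -1 := by rw [← him]; push_cast; rfl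
  push_cast at h2
  rw [cast_eq_one_of_odd _ hx, cast_eq_one_of_odd _ hy, one_mul, one_mul] at h2
  have := cofactor_norm_is_odd (w.re : ZMod 2) (w.im : ZMod 2) h2
  apply odd_of_cast_eq_one
  rw [hn]; push_cast; exact this

/-- **`A² + 7 = 2·t·n` with `n` odd forces `A` odd and `4 ∣ t`** (`A` even makes the left side odd; `A = 2k+1` gives
`A² + 7 = 8·(k(k+1)∕2 + 1)`, and `n` odd). [kernel] -/
theorem four_dvd_of_eq (A t n : ℤ) (hn : Odd n) (h : A ^ 2 + 7 = 2 * t * n) : Odd A ∧ (4 : ℤ) ∣ t := by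
  rcases Int.even_or_odd A with ⟨k, rfl⟩ | ⟨k, rfl⟩
  · exfalso
    have h1 : Odd ((k + k) ^ 2 + 7) := ⟨2 * k ^ 2 + 3, by ring⟩
    have h2 : Even (2 * t * n) := ⟨t * n, by ring⟩
    rw [h] at h1
    exact (Int.not_even_iff_odd.mpr h1) h2
  · refine ⟨⟨k, rfl⟩, ?_⟩
    obtain ⟨j, hj⟩ := Int.even_mul_succ_self k
    -- (2k+1)² + 7 = 4k(k+1) + 8 = 8j' … : 2 t n = 4·(k(k+1)) + 8
    have h3 : t * n = 2 * (k * (k + 1)) + 4 := by linarith [h]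
    rw [hj] at h3
    -- t * n = 4 * (j + 1) with n odd ⇒ 4 ∣ t
    obtain ⟨i, rfl⟩ := hn
    have h4 : Even (t * (2 * i + 1)) := ⟨2 * (j + 1) - 0, by linarith [h3]⟩
    have ht : Even t := by
      rcases Int.even_mul.mp h4 with ht | hi
      · exact ht
      · exact absurd hi (Int.not_even_iff_odd.mpr ⟨i, rfl⟩)
    obtain ⟨s, rfl⟩ := ht
    -- (s + s)(2i+1) = 4(j+1) ⇒ s(2i+1) = 2(j+1) ⇒ s even
    have h5 : Even (s * (2 * i + 1)) := ⟨j + 1, by linarith [h3]⟩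
    have hs : Even s := by
      rcases Int.even_mul.mp h5 with hs | hi
      · exact hs
      · exact absurd hi (Int.not_even_iff_odd.mpr ⟨i, rfl⟩)
    obtain ⟨r, rfl⟩ := hs
    exact ⟨r, by ring⟩

/-! ## §3 The obstruction -/

/-- **`ℚ(√−7)` does not reach R1 PROPER factorwise** (ONE-FOURIER-FORMULA-B.md §8, kernel form): there are no primitive `z, z₆ ∈ ℤ√(−7)`
with `N(z) = 2t`, `N(z₆) = t` that both divide `A − l = ⟨A, −1⟩`. Proof: `z` has odd coordinates (`odd_coords`), so `A² + 7 = 2t·N(w)`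
with `N(w)` odd (`odd_norm_cofactor`); then `4 ∣ t` (`four_dvd_of_eq`), so `z₆` has odd coordinates too and `A² + 7 = t·N(w₆)` with
`N(w₆)` odd; `t ≠ 0` (an odd coordinate), so `N(w₆) = 2·N(w)` — even, contradiction. [kernel] -/
theorem r1proper_not_factorwise_sqrt_neg_seven (t A : ℤ) (z z₆ w w₆ : ℤ√(-7))
    (hz : z.norm = 2 * t) (hz₆ : z₆.norm = t) (hcop : IsCoprime z.re z.im) (hcop₆ : IsCoprime z₆.re z₆.im)
    (h : (⟨A, -1⟩ : ℤ√(-7)) = z * w) (h₆ : (⟨A, -1⟩ : ℤ√(-7)) = z₆ * w₆) : False := by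
  -- norms of the two factorizations
  have hN : A ^ 2 + 7 = 2 * t * w.norm := by
    have := congrArg Zsqrtd.norm h
    rw [norm_A_sub_l, Zsqrtd.norm_mul, hz] at this
    exact this
  have hN₆ : A ^ 2 + 7 = t * w₆.norm := by
    have := congrArg Zsqrtd.norm h₆
    rw [norm_A_sub_l, Zsqrtd.norm_mul, hz₆] at this
    exact this
  -- z has odd coordinates, its cofactor odd norm
  obtain ⟨hx, hy⟩ := odd_coords z hcop ⟨t, by rw [hz]; ring⟩
  have hw : Odd w.norm := odd_norm_cofactor A z w hx hy h
  -- hence 4 ∣ t, so z₆ has odd coordinates and its cofactor odd norm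
  obtain ⟨_, ⟨s, hs⟩⟩ := four_dvd_of_eq A t w.norm hw hN
  obtain ⟨hu, hv⟩ := odd_coords z₆ hcop₆ ⟨2 * s, by rw [hz₆, hs]; ring⟩
  have hw₆ : Odd w₆.norm := odd_norm_cofactor A z₆ w₆ hu hv h₆
  -- t ≠ 0: z₆ has an odd (hence nonzero) coordinate and N(z₆) = u² + 7v² = t
  have ht : t ≠ 0 := by
    have hu0 : z₆.re ≠ 0 := by rintro h0; rw [h0] at hu; exact (by decide : ¬ Odd (0 : ℤ)) hu
    have : 0 < z₆.re ^ 2 + 7 * z₆.im ^ 2 := by positivity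
    have hn : z₆.norm = z₆.re ^ 2 + 7 * z₆.im ^ 2 := by rw [Zsqrtd.norm_def]; ring
    intro ht0
    rw [ht0] at hz₆
    linarith [hn]
  -- 2 t N(w) = t N(w₆) ⇒ N(w₆) = 2 N(w), even
  have heq : t * w₆.norm = t * (2 * w.norm) := by linarith [hN, hN₆]
  have heven : Even w₆.norm := ⟨w.norm, by have := mul_left_cancel₀ ht heq; linarith [this]⟩
  exact (Int.not_even_iff_odd.mpr hw₆) heven

/-! ## §4 The contrast of record: the fields that DO reach R1 proper -/

/-- **§8's positive words satisfy the divisibilities** (explicit products): `ℚ(i)`, `A = 1`, `z = 1 + i` (`N = 2 = 2·N(1)`):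
`1 − i = (1 + i)·(−i)`; `ℚ(√−2)`, `A = 0`, `z = √−2` (`N = 2`): `−√−2 = √−2·(−1)`; silver `ℚ(√2)`, `A = 0`, `z = 2 + √2` (`N = 2`):
`−√2 = (2 + √2)(1 − √2)`; in each case `z₆ = 1` (`N = 1 = t`) divides everything. [kernel] -/
theorem positive_fields :
    (⟨1, -1⟩ : ℤ√(-1)) = ⟨1, 1⟩ * ⟨0, -1⟩ ∧ (⟨1, 1⟩ : ℤ√(-1)).norm = 2 ∧
      (⟨0, -1⟩ : ℤ√(-2)) = ⟨0, 1⟩ * ⟨-1, 0⟩ ∧ (⟨0, 1⟩ : ℤ√(-2)).norm = 2 ∧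
      (⟨0, -1⟩ : ℤ√2) = ⟨2, 1⟩ * ⟨1, -1⟩ ∧ (⟨2, 1⟩ : ℤ√2).norm = 2 := by
  refine ⟨?_, ?_, ?_, ?_, ?_, ?_⟩
  · ext <;> simp
  · rw [Zsqrtd.norm_def]; rfl
  · ext <;> simp
  · rw [Zsqrtd.norm_def]; rfl
  · ext <;> simp
  · rw [Zsqrtd.norm_def]; rfl

end Summit.Ventures.HSemireg.R1SqrtMinusSeven
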